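import Literature.Probability.RandomPlanarGeometry.CaratheodoryHalfPlane
import Literature.Probability.RandomPlanarGeometry.HalfPlaneAutomorphism

/-!
# Welding continuity, part E: passage to the limit in the welding equation

Support file for item `stmt-CriticalPhenomena-4509` (`SAWWeldingIdentification.WeldingContinuity`).

Pure analysis, no curves: suppose the Carathéodory extensions of the disc charts of the left and
right banks converge uniformly on the closed disc, `F_L^n → F_L`, `F_R^n → F_R` (Radó), the limit
`F_L` being continuous and injective on `𝔻̄`, and the normalisation data converge
(`η^n → η`, `u^n → u`, `c^n → c ≠ 0`). If the welding values `h_n`, `h` solve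

`F_R^n (η_R^n · C (c_R^n s x + u_R^n)) = F_L^n (η_L^n · C (-c_L^n s h_n + u_L^n))`

(`C = cayleyFun`, `s = ±1`) and the same equation holds in the limit, then `h_n → h`
(`tendsto_weldValue`): the common point `F_R^n(…) → F_R(…)` by uniform convergence, so the circle
points `η_L^n C(…h_n…)` converge by injectivity of `F_L` on the compact disc
(`tendsto_of_injOn_of_tendsto_comp`), and `C` is inverted by the continuous `cayleyInvFun`.

References: Pommerenke (1992), §2.3 (Thm. 2.11, Radó; Cor. 2.4).
-/

noncomputable section

open Set Filter Metric Complex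
open scoped Topology
open UpperHalfPlane (upperHalfPlaneSet)
open Literature.Probability.RandomPlanarGeometry

namespace Summit.CriticalPhenomena.SAWScalingLimit.Theorems.WeldingContinuity

/-- `cayleyFun` is continuous at every point of the closed upper half-plane, in particular at
real points. [folklore] -/
theorem continuousAt_cayleyFun {z : ℂ} (hz : 0 ≤ z.im) : ContinuousAt cayleyFun z :=
  (continuousOn_cayleyFun z (add_I_ne_zero hz)).continuousAt
    ((isOpen_ne_fun (continuous_id.add continuous_const) continuous_const).mem_nhds
      (add_I_ne_zero hz))

/-- `cayleyFun` of a convergent real sequence converges. [folklore] -/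
theorem tendsto_cayleyFun_ofReal {r : ℕ → ℝ} {rl : ℝ} (hr : Tendsto r atTop (𝓝 rl)) :
    Tendsto (fun n => cayleyFun (r n)) atTop (𝓝 (cayleyFun rl)) :=
  ((continuousAt_cayleyFun (by simp)).tendsto).comp ((continuous_ofReal.tendsto rl).comp hr)

/-- The Cayley transform of a real number is never `1` (`1` is the image of `∞`). [folklore] -/
theorem cayleyFun_ofReal_ne_one (y : ℝ) : cayleyFun (y : ℂ) ≠ 1 := by
  intro h
  have hden : (y : ℂ) + I ≠ 0 := add_I_ne_zero (by simp)
  rw [cayleyFun_apply, div_eq_one_iff_eq hden] at h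
  have := congrArg Complex.im h
  simp at this
  norm_num at this

/-- `cayleyInvFun` is continuous away from `1`. [folklore] -/
theorem continuousAt_cayleyInvFun {w : ℂ} (hw : w ≠ 1) : ContinuousAt cayleyInvFun w :=
  (differentiableOn_cayleyInvFun.continuousOn w hw).continuousAt (isOpen_ne.mem_nhds hw)

/-- A point `η · cayleyFun y` (`|η| = 1`, `y` real) lies on the unit circle, hence in the closed
unit disc. [folklore] -/
theorem mul_cayleyFun_mem_closedBall {η : ℂ} (hη : ‖η‖ = 1) (y : ℝ) :
    η * cayleyFun (y : ℂ) ∈ closedBall (0 : ℂ) 1 := by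
  rw [mem_closedBall_zero_iff, norm_mul, hη, one_mul, norm_cayleyFun_ofReal]

/-- **Evaluating a uniformly convergent sequence along a convergent sequence of points**: if
`F_n → F` uniformly on `K`, `F` is continuous on `K`, `a_n ∈ K` and `a_n → a ∈ K`, then
`F_n (a_n) → F a`. [folklore] -/
theorem tendsto_apply_of_tendstoUniformlyOn {F : ℕ → ℂ → ℂ} {Fl : ℂ → ℂ} {K : Set ℂ}
    (hF : TendstoUniformlyOn F Fl atTop K) (hFlc : ContinuousOn Fl K) {a : ℕ → ℂ} {al : ℂ}
    (ha : ∀ n, a n ∈ K) (hal : al ∈ K) (hlim : Tendsto a atTop (𝓝 al)) :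
    Tendsto (fun n => F n (a n)) atTop (𝓝 (Fl al)) := by
  have h1 : Tendsto (fun n => Fl (a n)) atTop (𝓝 (Fl al)) :=
    (hFlc al hal).tendsto.comp (tendsto_nhdsWithin_iff.2 ⟨hlim, Eventually.of_forall ha⟩)
  refine h1.congr_dist ?_
  rw [Metric.tendsto_nhds]
  intro ε hε
  filter_upwards [Metric.tendstoUniformlyOn_iff.1 hF ε hε] with n hn
  rw [Real.dist_eq, sub_zero, abs_of_nonneg dist_nonneg]
  exact hn (a n) (ha n)

/-- **Preimages under a uniformly approximated injective map converge**: if `F_n → F` uniformly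
on the compact `K`, `F` continuous and injective on `K`, `b_n ∈ K`, `b ∈ K`, and
`F_n (b_n) → F b`, then `b_n → b`. [folklore] -/
theorem tendsto_of_tendstoUniformlyOn_of_injOn {F : ℕ → ℂ → ℂ} {Fl : ℂ → ℂ} {K : Set ℂ}
    (hK : IsCompact K) (hF : TendstoUniformlyOn F Fl atTop K) (hFlc : ContinuousOn Fl K)
    (hFli : InjOn Fl K) {b : ℕ → ℂ} {bl : ℂ} (hb : ∀ n, b n ∈ K) (hbl : bl ∈ K)
    (hlim : Tendsto (fun n => F n (b n)) atTop (𝓝 (Fl bl))) : Tendsto b atTop (𝓝 bl) := by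
  refine tendsto_of_injOn_of_tendsto_comp hK hFlc hFli (Eventually.of_forall hb) hbl ?_
  refine hlim.congr_dist ?_
  rw [Metric.tendsto_nhds]
  intro ε hε
  filter_upwards [Metric.tendstoUniformlyOn_iff.1 hF ε hε] with n hn
  rw [Real.dist_eq, sub_zero, abs_of_nonneg dist_nonneg, dist_comm]
  exact hn (b n) (hb n)

/-- **Passage to the limit in the welding equation.** See the module docstring.
[cite: PommerenkeBBCM1992, Thm. 2.11] -/
theorem tendsto_weldValue {FL FR : ℕ → ℂ → ℂ} {FLl FRl : ℂ → ℂ}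
    (hFLlc : ContinuousOn FLl (closedBall 0 1)) (hFLli : InjOn FLl (closedBall 0 1))
    (hFRlc : ContinuousOn FRl (closedBall 0 1))
    (hFL : TendstoUniformlyOn FL FLl atTop (closedBall 0 1))
    (hFR : TendstoUniformlyOn FR FRl atTop (closedBall 0 1))
    {ηL ηR : ℕ → ℂ} {ηLl ηRl : ℂ} (hηL1 : ∀ n, ‖ηL n‖ = 1) (hηLl1 : ‖ηLl‖ = 1)
    (hηR1 : ∀ n, ‖ηR n‖ = 1) (hηRl1 : ‖ηRl‖ = 1)
    (hηL : Tendsto ηL atTop (𝓝 ηLl)) (hηR : Tendsto ηR atTop (𝓝 ηRl))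
    {uL cL uR cR : ℕ → ℝ} {uLl cLl uRl cRl : ℝ} (hcLl : cLl ≠ 0)
    (huL : Tendsto uL atTop (𝓝 uLl)) (hcL : Tendsto cL atTop (𝓝 cLl))
    (huR : Tendsto uR atTop (𝓝 uRl)) (hcR : Tendsto cR atTop (𝓝 cRl))
    {h : ℕ → ℝ} {hl s x : ℝ} (hs : s = 1 ∨ s = -1)
    (heq : ∀ n, FR n (ηR n * cayleyFun ((cR n : ℂ) * ((s * x : ℝ) : ℂ) + uR n)) =
      FL n (ηL n * cayleyFun ((cL n : ℂ) * ((-(s * h n) : ℝ) : ℂ) + uL n)))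
    (heql : FRl (ηRl * cayleyFun ((cRl : ℂ) * ((s * x : ℝ) : ℂ) + uRl)) =
      FLl (ηLl * cayleyFun ((cLl : ℂ) * ((-(s * hl) : ℝ) : ℂ) + uLl))) :
    Tendsto h atTop (𝓝 hl) := by
  have hss : s * s = 1 := by rcases hs with rfl | rfl <;> norm_num
  -- real forms of the Cayley arguments
  set yR : ℕ → ℝ := fun n => cR n * (s * x) + uR n with hyR
  set yRl : ℝ := cRl * (s * x) + uRl with hyRl
  set yL : ℕ → ℝ := fun n => cL n * (-(s * h n)) + uL n with hyL
  set yLl : ℝ := cLl * (-(s * hl)) + uLl with hyLl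
  have eR : ∀ n, (cR n : ℂ) * ((s * x : ℝ) : ℂ) + uR n = ((yR n : ℝ) : ℂ) := fun n => by
    simp only [hyR]; push_cast; ring
  have eRl : (cRl : ℂ) * ((s * x : ℝ) : ℂ) + uRl = ((yRl : ℝ) : ℂ) := by
    simp only [hyRl]; push_cast; ring
  have eL : ∀ n, (cL n : ℂ) * ((-(s * h n) : ℝ) : ℂ) + uL n = ((yL n : ℝ) : ℂ) := fun n => by
    simp only [hyL]; push_cast; ring
  have eLl : (cLl : ℂ) * ((-(s * hl) : ℝ) : ℂ) + uLl = ((yLl : ℝ) : ℂ) := by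
    simp only [hyLl]; push_cast; ring
  simp only [eR, eL] at heq
  rw [eRl, eLl] at heql
  -- Step 1: the right-hand points converge, hence so do their images
  have hyRlim : Tendsto yR atTop (𝓝 yRl) := (hcR.mul tendsto_const_nhds).add huR
  have hA : Tendsto (fun n => ηR n * cayleyFun (yR n)) atTop (𝓝 (ηRl * cayleyFun yRl)) :=
    hηR.mul (tendsto_cayleyFun_ofReal hyRlim)
  have hFA : Tendsto (fun n => FR n (ηR n * cayleyFun (yR n))) atTop
      (𝓝 (FRl (ηRl * cayleyFun yRl))) :=
    tendsto_apply_of_tendstoUniformlyOn hFR hFRlc (fun n => mul_cayleyFun_mem_closedBall (hηR1 n) _)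
      (mul_cayleyFun_mem_closedBall hηRl1 _) hA
  -- Step 2: the left-hand circle points converge (injectivity of `FLl` on the compact disc)
  have hB : Tendsto (fun n => ηL n * cayleyFun (yL n)) atTop (𝓝 (ηLl * cayleyFun yLl)) := by
    refine tendsto_of_tendstoUniformlyOn_of_injOn (isCompact_closedBall 0 1) hFL hFLlc hFLli
      (fun n => mul_cayleyFun_mem_closedBall (hηL1 n) _) (mul_cayleyFun_mem_closedBall hηLl1 _) ?_
    rw [← heql]
    exact hFA.congr fun n => heq n
  -- Step 3: remove the rotation and invert the Cayley transform
  have hηLl0 : ηLl ≠ 0 := norm_ne_zero_iff.1 (by rw [hηLl1]; exact one_ne_zero)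
  have hηL0 : ∀ n, ηL n ≠ 0 := fun n => norm_ne_zero_iff.1 (by rw [hηL1 n]; exact one_ne_zero)
  have hC : Tendsto (fun n => cayleyFun (yL n)) atTop (𝓝 (cayleyFun yLl)) := by
    have h1 := (hηL.inv₀ hηLl0).mul hB
    rw [inv_mul_cancel_left₀ hηLl0] at h1
    exact h1.congr fun n => inv_mul_cancel_left₀ (hηL0 n) _
  have hY : Tendsto (fun n => ((yL n : ℝ) : ℂ)) atTop (𝓝 ((yLl : ℝ) : ℂ)) := by
    have h1 := ((continuousAt_cayleyInvFun (cayleyFun_ofReal_ne_one yLl)).tendsto).comp hC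
    rw [cayleyInvFun_cayleyFun (add_I_ne_zero (by simp))] at h1
    exact h1.congr fun n => cayleyInvFun_cayleyFun (add_I_ne_zero (by simp))
  have hy : Tendsto yL atTop (𝓝 yLl) := by
    have h1 : Tendsto (fun n => (((yL n : ℝ) : ℂ)).re) atTop (𝓝 ((yLl : ℝ) : ℂ).re) :=
      (continuous_re.tendsto _).comp hY
    simpa only [Complex.ofReal_re] using h1
  -- Step 4: solve for `h n`
  have hev : ∀ᶠ n in atTop, cL n ≠ 0 :=
    (hcL.eventually_ne hcLl)
  have hsol : ∀ᶠ n in atTop, h n = -(s * (yL n - uL n) / cL n) := by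
    filter_upwards [hev] with n hn
    simp only [hyL]
    field_simp
    linear_combination (-(h n * cL n)) * hss
  have hsoll : hl = -(s * (yLl - uLl) / cLl) := by
    simp only [hyLl]
    field_simp
    linear_combination (-(hl * cLl)) * hss
  have hlim : Tendsto (fun n => -(s * (yL n - uL n) / cL n)) atTop
      (𝓝 (-(s * (yLl - uLl) / cLl))) :=
    ((tendsto_const_nhds.mul (hy.sub huL)).div hcL hcLl).neg
  rw [hsoll]
  exact hlim.congr' (EventuallyEq.symm hsol)

end Summit.CriticalPhenomena.SAWScalingLimit.Theorems.WeldingContinuity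

end
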